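import Literature.NumberTheory.NumberFields.ArithmeticEquivalenceGassmannProofs
import Literature.NumberTheory.LFunctions.DedekindZetaProofs
import Literature.NumberTheory.LFunctions.AbelianFieldDedekindZeta
import Literature.NumberTheory.LFunctions.DedekindZeta
import HarnessLib

/-!
# Crux `DedekindQuotientEntire` (stmt-Langlands-17271), line `Sketch` — stub B

`stub_hasProd_primes_dedekindZeta`: the Euler product of the Dedekind zeta function
`ζ_K(s) = ∏_v (1 - N(v)^{-s})⁻¹` (`hasProd_dedekindEulerFactor_holds`, over the finite places `v`
of `K`) regrouped along the rational prime below `v`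
(`Equiv.sigmaFiberEquiv primeBelow`, `HasProd.sigma`), the fibre product over `p` being
`∏_{f ∈ splittingType K p} (1 - p^{-fs})⁻¹`
(`AbelianSplitting.prod_fiber_eq_prod_map_splittingType`, `absNorm_eq_pow_inertiaDeg`).
-/

set_option linter.dupNamespace false

noncomputable section

open scoped NumberField
open Polynomial Complex Filter IsDedekindDomain
open Literature.NumberTheory.LFunctions Literature.NumberTheory.LFunctions.NumberField
open Literature.NumberTheory.NumberFields
-- (the skeleton's `open Literature.NumberTheory.Automorphic`,
-- `open Literature.NumberTheory.GaloisRepresentations` and its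
-- `import Summits.Langlands.Langlands.Theses.DedekindQuotient1951` are not needed here: the
-- statement only mentions `splittingType`, `NumberField.dedekindZeta`, `Nat.Primes`, `HasProd`)

namespace Summit.Langlands.Langlands.Theorems.DedekindQuotientEntire

-- adapted from Summits/QuantumAdvantage/QuantumAdvantage/Theorems/
--   LinnikCubicClassGroupsDegreeOnePrimesEscapeDedekindRelation.lean
--   (`prod_fiber_dedekindEulerFactor_eq_prod_map`, `hasProd_primes_dedekindZeta`)

/-- The Euler factor of `ζ_K` at `p`, as a product over the splitting type of `p` in `K`:
`∏_{v ∣ p} (1 - N(v)^{-s})⁻¹ = ∏_{f ∈ splittingType K p} (1 - p^{-fs})⁻¹`. -/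
private theorem prod_fiber_dedekindEulerFactor_eq_prod_map (K : Type*) [Field K] [NumberField K]
    (p : Nat.Primes) (s : ℂ) :
    ∏ v : {v : HeightOneSpectrum (𝓞 K) // primeBelow v = p}, dedekindEulerFactor K v.1 s =
      ((splittingType K p).map fun f : ℕ => (1 - (((p : ℕ) : ℂ) ^ (-s)) ^ f)⁻¹).prod := by
  have h1 : ∏ v : {v : HeightOneSpectrum (𝓞 K) // primeBelow v = p}, dedekindEulerFactor K v.1 s =
      ∏ v : {v : HeightOneSpectrum (𝓞 K) // primeBelow v = p},
        (fun f : ℕ => (1 - (((p : ℕ) : ℂ) ^ (-s)) ^ f)⁻¹) (v.1.asIdeal.inertiaDeg ℤ) := by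
    refine Finset.prod_congr rfl fun v _ => ?_
    rw [dedekindEulerFactor, absNorm_eq_pow_inertiaDeg v, Nat.cast_pow,
      ← Complex.natCast_cpow_natCast_mul, Complex.cpow_nat_mul]
  rw [h1, AbelianSplitting.prod_fiber_eq_prod_map_splittingType p
    (fun f : ℕ => (1 - (((p : ℕ) : ℂ) ^ (-s)) ^ f)⁻¹)]

/-- **`ζ_K(s) = ∏_p ∏_{f ∈ splittingType K p} (1 - p^{-fs})⁻¹`** for `Re s > 1` (stub B): the
Euler product of the Dedekind zeta function (`hasProd_dedekindEulerFactor_holds`) regrouped along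
the rational prime below (`Equiv.sigmaFiberEquiv primeBelow`, `HasProd.sigma`), each fibre
product identified with the splitting type (`prod_fiber_eq_prod_map_splittingType`). -/
theorem stub_hasProd_primes_dedekindZeta (K : Type) [Field K] [NumberField K] {s : ℂ}
    (hs : 1 < s.re) :
    HasProd (fun p : Nat.Primes =>
      ((splittingType K p).map fun f : ℕ => (1 - (((p : ℕ) : ℂ) ^ (-s)) ^ f)⁻¹).prod)
      (NumberField.dedekindZeta K s) := by
  have hD := hasProd_dedekindEulerFactor_holds K hs
  have hD' := (Equiv.hasProd_iff (Equiv.sigmaFiberEquiv (primeBelow (K := K)))).mpr hD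
  have hD'' : HasProd (fun p : Nat.Primes ↦
      ∏ v : {v : HeightOneSpectrum (𝓞 K) // primeBelow v = p}, dedekindEulerFactor K v.1 s)
      (NumberField.dedekindZeta K s) := by
    refine hD'.sigma fun p ↦ ?_
    simpa only [Function.comp_def, Equiv.sigmaFiberEquiv_apply] using
      hasProd_fintype (fun v : {v : HeightOneSpectrum (𝓞 K) // primeBelow v = p} ↦
        dedekindEulerFactor K v.1 s)
  simpa only [prod_fiber_dedekindEulerFactor_eq_prod_map] using hD''

end Summit.Langlands.Langlands.Theorems.DedekindQuotientEntire
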